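import Summits.KontsevichZagierPeriods.KontsevichZagierPeriods.Theorems.ValuedFieldSpecialisationClassLevelExpansionFibreDimOneElementaryA

/-!
# Route ValuedFieldSpecialisation — existence of the elementary divergent products

Helper for item stmt-KontsevichZagierPeriods-3503 (`ClassLevelExpansionFibreDimOne`), second of
two files. The item asks for `ℤ`-combinations of ELEMENTARY DIVERGENT PRODUCT representations `P`
of dimension `b + d + 2` in coordinates `(s, u, y₁…y_b, w₁…w_d)`: domain `0 < s < 1`, `0 < u`,
`u^q s^p < 1`, `s ≤ y_j ≤ 1`, `w ∈ ρ.domain`, integrand `∏ y_j⁻¹ · ρ.integrand w`. Such a `P`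
must be an absolutely convergent integral representation; its total integral is
`(∫₀¹ s^(−p/q) (log 1/s)^b ds) · ∫ |ρ|`, finite iff `p < q` (or `ρ` negligible). This file proves
the EXISTENCE of these representations for all `p < q`, `b`, `d`, `ρ` (`exists_elementaryRep`),
the integrability (`integrableOn_elementaryIntegrand`) coming from a SEPARABLE domination: with
`A = p/q < 1`, `γ = (3 − A)/2 ∈ (1, 1/A)` and `δ = (1 − Aγ)/(2b + 2)`, on the domain
`∏ y_j⁻¹ |ρ w| ≤ s^(−(Aγ + bδ)) · F(u) · ∏ y_j^(−(1−δ)) · |ρ w|`, `F = 𝟙_(0,1] + 𝟙_(1,∞) u^(−γ)`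
(because `u < s^(−A)` there), a product of integrable functions of disjoint groups of coordinates.

Sources: M. Kontsevich, D. Zagier, *Periods* (2001), §1.1 (absolutely convergent integrals of
semialgebraic functions); G. Comte, J.-M. Lion, J.-P. Rolin (2000) for the monomials
`s^a (log s)^b` these products realise. The encoding is this route's. Deliberately NOT here: the
slice values `s^(−p/q) (log 1/s)^b · ρ.value`, and the families without padding coordinate.
-/

noncomputable section

namespace Summit.KontsevichZagierPeriods.ValuedFieldSpecialisation

open MeasureTheory Set Filter MvPolynomial
open scoped Topology
open Literature.NumberTheory.Transcendental Literature.NumberTheory.Transcendental.KZ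
open Literature.ModelTheory.ExponentialFields (IsSemialgebraic)

variable {d : ℕ}

/-! ### Integrability and existence -/

/-- **Integrability of the elementary products** (`p < q`): the integrand `∏ y_j⁻¹ · ρ.integrand w`
is absolutely integrable on the elementary domain, by the separable domination described in the
module docstring. [folklore] -/
theorem integrableOn_elementaryIntegrand {p q b : ℕ} (hpq : p < q) (ρ : IntegralRep d) :
    IntegrableOn (fun z : Fin (b + d + 1 + 1) → ℝ => (∏ j : Fin b, (z (Fin.castAdd d j).succ.succ)⁻¹) *
        ρ.integrand (fun l : Fin d => z (Fin.natAdd b l).succ.succ))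
      {z | 0 < z 0 ∧ z 0 < 1 ∧ 0 < z 1 ∧ z 1 ^ q * z 0 ^ p < 1 ∧
        (∀ j : Fin b, z 0 ≤ z (Fin.castAdd d j).succ.succ ∧ z (Fin.castAdd d j).succ.succ ≤ 1) ∧
        (fun l : Fin d => z (Fin.natAdd b l).succ.succ) ∈ ρ.domain} := by
  -- exponents
  have hq : 0 < q := lt_of_le_of_lt (Nat.zero_le p) hpq
  have hq0 : (0 : ℝ) < q := by exact_mod_cast hq
  set A : ℝ := (p : ℝ) / q with hA
  have hA0 : 0 ≤ A := div_nonneg (Nat.cast_nonneg p) hq0.le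
  have hA1 : A < 1 := by
    rw [hA, div_lt_one hq0]
    exact_mod_cast hpq
  set γ : ℝ := (3 - A) / 2 with hγ
  have hγ1 : 1 < γ := by rw [hγ]; linarith
  have hAγ : A * γ < 1 := by
    rw [hγ]
    nlinarith
  have hAγ0 : 0 ≤ A * γ := mul_nonneg hA0 (by linarith)
  set δ : ℝ := (1 - A * γ) / (2 * (b + 1)) with hδ
  have hb1 : (0 : ℝ) < 2 * (b + 1) := by positivity
  have hδ0 : 0 < δ := div_pos (by linarith) hb1
  have hbδ : (b : ℝ) * δ ≤ (1 - A * γ) / 2 := by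
    rw [hδ, mul_div_assoc']
    rw [div_le_div_iff₀ hb1 two_pos]
    nlinarith
  set e₁ : ℝ := A * γ + b * δ with he₁
  have he₁1 : e₁ < 1 := by rw [he₁]; linarith
  -- the four envelopes
  set f₁ : ℝ → ℝ := (Ioo (0 : ℝ) 1).indicator fun s => s ^ (-e₁) with hf₁
  set f₂ : ℝ → ℝ := fun u => (Ioc (0 : ℝ) 1).indicator (fun _ => (1 : ℝ)) u +
    (Ioi (1 : ℝ)).indicator (fun u => u ^ (-γ)) u with hf₂
  set f₃ : ℝ → ℝ := (Ioc (0 : ℝ) 1).indicator fun y => y ^ (-(1 - δ)) with hf₃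
  set f₄ : (Fin d → ℝ) → ℝ := ρ.domain.indicator fun w => |ρ.integrand w| with hf₄
  have hf₁i : Integrable f₁ := integrable_indicator_Ioo_rpow_neg he₁1
  have hf₂i : Integrable f₂ := integrable_paddingEnvelope hγ1
  have hf₃i : Integrable f₃ := integrable_indicator_Ioc_rpow_neg (by linarith)
  have hf₄i : Integrable f₄ :=
    (integrable_indicator_iff (IntegralRep.measurableSet_domain_holds ρ)).mpr ρ.integrableOn.abs
  have hf₁0 : ∀ s, 0 ≤ f₁ s := fun s => by
    rw [hf₁]; exact indicator_nonneg (fun s hs => Real.rpow_nonneg hs.1.le _) s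
  have hf₂0 : ∀ u, 0 ≤ f₂ u := fun u => by
    rw [hf₂]
    exact add_nonneg (indicator_nonneg (fun _ _ => zero_le_one) u)
      (indicator_nonneg (fun u hu => Real.rpow_nonneg (zero_le_one.trans (le_of_lt hu)) _) u)
  have hf₃0 : ∀ y, 0 ≤ f₃ y := fun y => by
    rw [hf₃]; exact indicator_nonneg (fun y hy => Real.rpow_nonneg hy.1.le _) y
  have hf₄0 : ∀ w, 0 ≤ f₄ w := fun w => by
    rw [hf₄]; exact indicator_nonneg (fun w _ => abs_nonneg _) w
  -- the separable envelope on `ℝᵇ⁺ᵈ⁺²`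
  have hΦ : Integrable (fun z : Fin (b + d + 1 + 1) → ℝ => f₁ (z 0) * (f₂ (z (Fin.succ 0)) *
      ((∏ j : Fin b, f₃ (z (Fin.castAdd d j).succ.succ)) *
        f₄ (fun l : Fin d => z (Fin.natAdd b l).succ.succ)))) :=
    integrable_cons_mul hf₁i (integrable_cons_mul hf₂i
      (integrable_append_mul (integrable_pi_prod hf₃i) hf₄i))
  -- measurability of the integrand extended by zero
  set D := {z : Fin (b + d + 1 + 1) → ℝ | 0 < z 0 ∧ z 0 < 1 ∧ 0 < z 1 ∧ z 1 ^ q * z 0 ^ p < 1 ∧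
    (∀ j : Fin b, z 0 ≤ z (Fin.castAdd d j).succ.succ ∧ z (Fin.castAdd d j).succ.succ ≤ 1) ∧
    (fun l : Fin d => z (Fin.natAdd b l).succ.succ) ∈ ρ.domain} with hD
  have hDsa : IsSemialgebraic ℚ D := isSemialgebraic_elementaryDomain p q b ρ
  have hDm : MeasurableSet D := IsSemialgebraic.measurableSet_holds hDsa
  have hypos : ∀ z ∈ D, ∀ j : Fin b, 0 < z (Fin.castAdd d j).succ.succ :=
    fun z hz j => hz.1.trans_le (hz.2.2.2.2.1 j).1
  have hFsa := isSemialgebraicFunOn_elementaryIntegrand ρ hDsa (fun z hz j => (hypos z hz j).ne')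
    (fun z hz => hz.2.2.2.2.2)
  have hmeas := hFsa.measurable_indicator_of_tarskiSeidenberg
    Literature.ModelTheory.ExponentialFields.tarski_seidenberg_real_holds hDm
  -- the pointwise bound
  refine (integrable_indicator_iff hDm).mp (hΦ.mono' hmeas.aestronglyMeasurable
    (Eventually.of_forall fun z => ?_))
  by_cases hz : z ∈ D
  swap
  · rw [indicator_of_notMem hz, norm_zero]
    exact mul_nonneg (hf₁0 _) (mul_nonneg (hf₂0 _) (mul_nonneg
      (Finset.prod_nonneg fun j _ => hf₃0 _) (hf₄0 _)))
  rw [indicator_of_mem hz]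
  obtain ⟨hs0, hs1, hu0, huq, hyj, hwρ⟩ := hz
  simp only [Fin.succ_zero_eq_one]
  -- values of the envelopes at the point
  have hv₁ : f₁ (z 0) = z 0 ^ (-e₁) := by rw [hf₁, indicator_of_mem (show z 0 ∈ Ioo (0:ℝ) 1 from ⟨hs0, hs1⟩)]
  have hv₃ : ∀ j : Fin b, f₃ (z (Fin.castAdd d j).succ.succ) = z (Fin.castAdd d j).succ.succ ^ (-(1 - δ)) :=
    fun j => by
      rw [hf₃, indicator_of_mem]
      exact ⟨hs0.trans_le (hyj j).1, (hyj j).2⟩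
  have hv₄ : f₄ (fun l : Fin d => z (Fin.natAdd b l).succ.succ) =
      |ρ.integrand (fun l : Fin d => z (Fin.natAdd b l).succ.succ)| := by
    rw [hf₄, indicator_of_mem hwρ]
  have hv₂ : 1 ≤ z 0 ^ (-(A * γ)) * f₂ (z 1) := by
    have hsAγ : 1 ≤ z 0 ^ (-(A * γ)) :=
      Real.one_le_rpow_of_pos_of_le_one_of_nonpos hs0 hs1.le (by linarith)
    by_cases hu1 : z 1 ≤ 1
    · have : f₂ (z 1) = 1 := by
        rw [hf₂]
        simp only [indicator_of_mem (show z 1 ∈ Ioc (0:ℝ) 1 from ⟨hu0, hu1⟩),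
          indicator_of_notMem (show z 1 ∉ Ioi (1:ℝ) from not_lt.mpr hu1), add_zero]
      rw [this, mul_one]
      exact hsAγ
    · push Not at hu1
      have : f₂ (z 1) = z 1 ^ (-γ) := by
        rw [hf₂]
        simp only [indicator_of_notMem (show z 1 ∉ Ioc (0:ℝ) 1 from fun h => (not_le.mpr hu1) h.2),
          indicator_of_mem (show z 1 ∈ Ioi (1:ℝ) from hu1), zero_add]
      rw [this]
      have hult : z 1 < z 0 ^ (-A) := by
        have := lt_rpow_neg_div_of_pow_mul_pow_lt_one hs0 hq huq
        rwa [hA, ← neg_div]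
      have hγ0 : 0 < γ := by linarith
      have h1 : z 1 ^ γ < z 0 ^ (-(A * γ)) := by
        have := Real.rpow_lt_rpow hu0.le hult hγ0
        rwa [← Real.rpow_mul hs0.le, neg_mul] at this
      have hzγ : 0 < z 1 ^ γ := Real.rpow_pos_of_pos hu0 _
      rw [Real.rpow_neg hu0.le, ← div_eq_mul_inv, le_div_iff₀ hzγ, one_mul]
      exact h1.le
  -- the `y`-product
  have hprod : ∏ j : Fin b, (z (Fin.castAdd d j).succ.succ)⁻¹ ≤
      z 0 ^ (-((b : ℝ) * δ)) * ∏ j : Fin b, f₃ (z (Fin.castAdd d j).succ.succ) := by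
    calc ∏ j : Fin b, (z (Fin.castAdd d j).succ.succ)⁻¹
        ≤ ∏ j : Fin b, (z 0 ^ (-δ) * z (Fin.castAdd d j).succ.succ ^ (-(1 - δ))) :=
          Finset.prod_le_prod (fun j _ => (inv_pos.mpr (hypos z ⟨hs0, hs1, hu0, huq, hyj, hwρ⟩ j)).le)
            fun j _ => inv_le_rpow_mul_rpow hs0 (hyj j).1 hδ0.le
      _ = z 0 ^ (-((b : ℝ) * δ)) * ∏ j : Fin b, f₃ (z (Fin.castAdd d j).succ.succ) := by
          rw [Finset.prod_mul_distrib, Finset.prod_const, Finset.card_univ, Fintype.card_fin,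
            ← Real.rpow_natCast, ← Real.rpow_mul hs0.le]
          congr 1
          · congr 1; ring
          · exact Finset.prod_congr rfl fun j _ => (hv₃ j).symm
  have hprod0 : 0 ≤ ∏ j : Fin b, f₃ (z (Fin.castAdd d j).succ.succ) :=
    Finset.prod_nonneg fun j _ => hf₃0 _
  -- assemble
  have habs : 0 ≤ |ρ.integrand (fun l : Fin d => z (Fin.natAdd b l).succ.succ)| := abs_nonneg _
  have hinv0 : 0 ≤ ∏ j : Fin b, (z (Fin.castAdd d j).succ.succ)⁻¹ :=
    Finset.prod_nonneg fun j _ => (inv_pos.mpr (hypos z ⟨hs0, hs1, hu0, huq, hyj, hwρ⟩ j)).le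
  rw [Real.norm_eq_abs, abs_mul, abs_of_nonneg hinv0, hv₁, hv₄]
  calc (∏ j : Fin b, (z (Fin.castAdd d j).succ.succ)⁻¹) *
        |ρ.integrand (fun l : Fin d => z (Fin.natAdd b l).succ.succ)|
      ≤ (z 0 ^ (-((b : ℝ) * δ)) * ∏ j : Fin b, f₃ (z (Fin.castAdd d j).succ.succ)) *
          |ρ.integrand (fun l : Fin d => z (Fin.natAdd b l).succ.succ)| :=
        mul_le_mul_of_nonneg_right hprod habs
    _ ≤ (z 0 ^ (-((b : ℝ) * δ)) * ∏ j : Fin b, f₃ (z (Fin.castAdd d j).succ.succ)) *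
          |ρ.integrand (fun l : Fin d => z (Fin.natAdd b l).succ.succ)| *
          (z 0 ^ (-(A * γ)) * f₂ (z 1)) :=
        le_mul_of_one_le_right (mul_nonneg (mul_nonneg (Real.rpow_nonneg hs0.le _) hprod0) habs) hv₂
    _ = z 0 ^ (-e₁) * (f₂ (z 1) * ((∏ j : Fin b, f₃ (z (Fin.castAdd d j).succ.succ)) *
          |ρ.integrand (fun l : Fin d => z (Fin.natAdd b l).succ.succ)|)) := by
        have : z 0 ^ (-e₁) = z 0 ^ (-(A * γ)) * z 0 ^ (-((b : ℝ) * δ)) := by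
          rw [← Real.rpow_add hs0]; congr 1; rw [he₁]; ring
        rw [this]; ring

/-- **The elementary divergent products exist.** For `p < q`, every `b`, and every representation
`ρ` of dimension `d`, there is an integral representation `P` of dimension `b + d + 2` whose domain
and integrand are LITERALLY those of the item's elementary clause:
`{(s, u, y, w) | 0 < s < 1, 0 < u, u^q s^p < 1, s ≤ y_j ≤ 1, w ∈ ρ.domain}`,
`∏ y_j⁻¹ · ρ.integrand w`. (For `q ≤ p` and `∫ |ρ| ≠ 0` no such representation exists: the total
integral is `∫₀¹ s^(−p/q) (log 1/s)^b ds · ∫ |ρ| = ∞`.) [Kontsevich–Zagier 2001, §1.1] [folklore] -/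
theorem exists_elementaryRep {p q b : ℕ} (hpq : p < q) (ρ : IntegralRep d) :
    ∃ P : IntegralRep (b + d + 1 + 1),
      P.domain = {z | ∃ (s u : ℝ) (y : Fin b → ℝ) (w : Fin d → ℝ),
        z = Matrix.vecCons s (Matrix.vecCons u (Fin.append y w)) ∧ 0 < s ∧ s < 1 ∧ 0 < u ∧
          u ^ q * s ^ p < 1 ∧ (∀ j, s ≤ y j ∧ y j ≤ 1) ∧ w ∈ ρ.domain} ∧
      P.integrand = fun z => (∏ j : Fin b, (z (Fin.castAdd d j).succ.succ)⁻¹) *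
        ρ.integrand (fun l : Fin d => z (Fin.natAdd b l).succ.succ) := by
  have hD := elementaryDomain_eq p q b ρ
  have hDsa : IsSemialgebraic ℚ {z : Fin (b + d + 1 + 1) → ℝ | ∃ (s u : ℝ) (y : Fin b → ℝ) (w : Fin d → ℝ),
      z = Matrix.vecCons s (Matrix.vecCons u (Fin.append y w)) ∧ 0 < s ∧ s < 1 ∧ 0 < u ∧
        u ^ q * s ^ p < 1 ∧ (∀ j, s ≤ y j ∧ y j ≤ 1) ∧ w ∈ ρ.domain} := by
    rw [hD]; exact isSemialgebraic_elementaryDomain p q b ρ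
  refine ⟨⟨_, _, hDsa, ?_, ?_⟩, rfl, rfl⟩
  · rw [hD]
    refine isSemialgebraicFunOn_elementaryIntegrand ρ (isSemialgebraic_elementaryDomain p q b ρ)
      (fun z hz j => (hz.1.trans_le (hz.2.2.2.2.1 j).1).ne') fun z hz => hz.2.2.2.2.2
  · rw [hD]
    exact integrableOn_elementaryIntegrand hpq ρ

end Summit.KontsevichZagierPeriods.ValuedFieldSpecialisation
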